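import Literature.MathematicalPhysics.QuantumFieldTheory.Balaban1983to89.B11Eq98CurrentSlot
import Literature.MathematicalPhysics.QuantumFieldTheory.Balaban1983to89.B11Eq88TransposeComposite

/-!
# `Balaban1983to89.B11Eq98W80Composite` — T. Bałaban, *The variational problem and background fields in renormalization group method for lattice gauge
# theories*, Commun. Math. Phys. **102** (1985) 277–309 [Balaban1985Variational] Prop. 4 (97)–(98) pp. 292–293 («The constants a₃, C₄ depend on d and L
# only»), (87)–(89) p. 291 («Applying the inequalities (3.132) from [5], (55), (73) … we can estimate this functional derivative by O(1)ε₁(Lʲη)⁻³ on Ω_j»):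
# **PROPOSITION 4 FOR THE OBJECT `W80` WITH THE W₂/W₃ ROWS TYPED THROUGH THE COMPOSITE LETTERS `N₁ = ‖Δπ∘H‖` AND `θ_E′` (the column letter of
# `Δπ∘(HD)′(A′)`) INSTEAD OF THE OPERATOR NORM `‖Δπ‖`** — `B11Eq98CurrentSlot.quadAnalytic_W80` RE-TYPED so that its constant `C₄ᶜ` is lattice-free
# whenever its letters are (NE9 leaf-01 memo `LOCATED-after-g97.md` §2 (E′): `‖Δπ‖_{(1,2)→(−3)} ≳ η⁻¹` is NOT a lattice-free letter; `N₁`, `θ_E′` are,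
# by `B11Eq88LaplaceH1Current{Letter,Norm,Column}` and (68))

WHAT THIS FILE PROVES (0 def, 0 sorry, axioms standard).  §1 `norm_W2_le_composite` — `‖W₂(A′)‖ ≤ (N₁C₂ℓ² + ‖ρ‖‖τ‖θ_E′)‖A′‖²`
(the row `Δ_π HD(A′) = Δπ(H(C(A)))` through `hN₁ : ‖Δπ(HX)‖ ≤ N₁‖X‖`, (46)/(55)/(57); the transposed row through `B11Eq88TransposeComposite.norm_transCur_le_of_symm`
and the DISPLAYED composite column letter `θ_E′`); `norm_W3_le_composite` — `‖W₃(A′)‖ ≤ ‖ρ‖‖τ‖θ_E·N₁C₂ℓ²·R′·‖A′‖²` (old transpose route, `K = Δπ HD(A′)`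
sized by `N₁`); §2 **`norm_W80_le_sq_composite`**, **`quadAnalytic_W80_composite`**, `prop4Hyp_W80_composite` — verbatim
`B11Eq98CurrentSlot` §3 with the two rows replaced.  LETTERS DISPLAYED: `hsym` (the (27)-symmetry of `Δπ`, at the chain's letters
`B9Eq3119DeltaPiCarrier.pairSum_currentCLM_comm`), `hN₁`, `hΘ′` (linear in `‖A′‖`), and the old `θ_E`, `θ₃`, `C_V`, `R_V`, `‖J‖`.
HONEST SCOPE.  No lattice-uniformity adjudicated HERE (that is the suppliers' business); nothing printed asserted beyond the (98) SHAPE; NE9 NOT PRINTED ∕ NOT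
PROVED; spine PROVED 0∕9; NOT infinite volume, NOT mass gap, NOT Clay.  HONEST DEPENDENCY: continuum YM on T⁴ ⇐ BetaPertH ∧ nine spine estimates (0/9
proved); BetaPertH ⇐ (D1) ∧ (D4) ∧ CAP+tail; G-an2-4 gates asym, D1 and NE2/3/4.  NEW file; nothing modified.  Net new unproved facts: 0.
-/

noncomputable section

open NormedSpace Complex Metric Set Finset Filter Topology

namespace Literature.MathematicalPhysics.QuantumFieldTheory.Balaban1983to89.B11Eq98W80Composite

open Literature.MathematicalPhysics.QuantumFieldTheory.Balaban1983to89.B11Prop6Scheme (Prop4Hyp)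
open Literature.MathematicalPhysics.QuantumFieldTheory.Balaban1983to89.B13Contraction113 (QuadAnalytic)
open Literature.MathematicalPhysics.QuantumFieldTheory.Balaban1983to89.B11Eq174Chart (solA Regime)
open Literature.MathematicalPhysics.QuantumFieldTheory.Balaban1983to89.B11Eq90V0primeCurrent (Tsh Ucur curL curL_apply flat115 flat115_apply
  differentiable_curV0prime)
open Literature.MathematicalPhysics.QuantumFieldTheory.Balaban1983to89.B11Eq96CommutatorCurrent (differentiable_curComm)
open Literature.MathematicalPhysics.QuantumFieldTheory.Balaban1983to89.B11Eq63V0GroupCurrent (curV0)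
open Literature.MathematicalPhysics.QuantumFieldTheory.Balaban1983to89.B11Eq90Transpose
open Literature.MathematicalPhysics.QuantumFieldTheory.Balaban1983to89.B11Eq90Pullback
open Literature.MathematicalPhysics.QuantumFieldTheory.Balaban1983to89.B11Eq90V0GroupComposed
open Literature.MathematicalPhysics.QuantumFieldTheory.Balaban1983to89.B11Eq80Current
open Literature.MathematicalPhysics.QuantumFieldTheory.Balaban1983to89.B11Eq98CurrentSlot (norm_Emap_le norm_Emap_le_sq norm_W1_le)
open Literature.MathematicalPhysics.QuantumFieldTheory.Balaban1983to89.B11Eq88TransposeComposite (norm_transCur_le_of_symm)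
open B9SectCLatticeCarrier (Bond)
open B4Sect5Torus (TSite)
open B11Eq115Space

variable {𝔸 : Type*} [NormedRing 𝔸] [NormedAlgebra ℂ 𝔸] [FiniteDimensional ℂ 𝔸]
variable {d : ℕ} {Pd : Fin d → ℕ} {L η : ℝ} [Fact (0 < L)] [Fact (0 < η)] {lev₀ : Bond d Pd → ℕ} {κ' : Type*} [Fintype κ']
  {lev₁ : κ' → ℕ} {Dc : (Bond d Pd → 𝔸) →ₗ[ℂ] (κ' → 𝔸)}
variable {𝒳 : Type*} [NormedAddCommGroup 𝒳] [NormedSpace ℂ 𝒳]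
variable {H : 𝒳 →L[ℂ] Space115 L η lev₀ lev₁ Dc} {C : Space115 L η lev₀ lev₁ Dc → 𝒳} {b C₂ c₄ aC εC : ℝ}

/-! ## §1 The W₂/W₃ rows through the composite letters -/

variable (ρ : (𝔸 →L[ℂ] ℂ) →L[ℂ] 𝔸) (τ : 𝔸 →L[ℂ] ℂ)

/-- **`‖Δπ HD(A′)‖₍₋₃₎ ≤ N₁·C₂ℓ²·‖A′‖²`** on `‖A′‖ < a_C` — `HD(A′) = H(C(A))` ((48)–(49)), `‖Δπ(HX)‖ ≤ N₁‖X‖` (the composite letter), `‖C(A)‖ ≤ C₂‖A‖²`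
((46)), `‖A‖ ≤ ℓ‖A′‖` ((57)). [cite: Balaban1985Variational, (88) p.291, (46) p.285, (55)–(57) p.286] -/
theorem norm_Δπ_Emap_le (RC : Regime H 0 C b 0 C₂ c₄ 0 aC εC) (Δπ : Space115 L η lev₀ lev₁ Dc →L[ℂ] NegSize L η lev₀ 3 𝔸)
    {N₁ : ℝ} (hN₁0 : 0 ≤ N₁) (hN₁ : ∀ X : 𝒳, ‖Δπ (H X)‖ ≤ N₁ * ‖X‖) {A' : Space115 L η lev₀ lev₁ Dc} (hA' : ‖A'‖ < aC) :
    ‖Δπ (Emap H C εC A')‖ ≤ N₁ * C₂ * (1 / (1 - 4 * b * C₂ * (εC + aC))) ^ 2 * ‖A'‖ ^ 2 := by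
  have hT : ‖T47 H C εC A'‖ < c₄ := by
    have h := norm_T47_lt RC hA'
    linarith [RC.dom, RC.ε₄_nonneg, norm_nonneg (T47 H C εC A')]
  have hT' : ‖T47 H C εC A'‖ ≤ 1 / (1 - 4 * b * C₂ * (εC + aC)) * ‖A'‖ := by
    rw [one_div_mul_eq_div]; exact norm_T47_le RC hA'
  rw [Emap_eq_H RC hA']
  calc ‖Δπ (H (C (T47 H C εC A')))‖ ≤ N₁ * ‖C (T47 H C εC A')‖ := hN₁ _
    _ ≤ N₁ * (C₂ * ‖T47 H C εC A'‖ ^ 2) := mul_le_mul_of_nonneg_left (RC.quad.quad _ hT) hN₁0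
    _ ≤ N₁ * (C₂ * (1 / (1 - 4 * b * C₂ * (εC + aC)) * ‖A'‖) ^ 2) := by have := RC.C₄_nonneg; gcongr
    _ = N₁ * C₂ * (1 / (1 - 4 * b * C₂ * (εC + aC))) ^ 2 * ‖A'‖ ^ 2 := by ring

/-- **(88)-form through the composite letters: `‖W₂(A′)‖₍₋₃₎ ≤ (N₁C₂ℓ² + ‖ρ‖‖τ‖θ_E′)·‖A′‖²`** on `‖A′‖ < a_C` — `Δ_π HD(A′)` by `norm_Δπ_Emap_le`; the
transposed `𝔇*(A′)H*Δ_π A′` by the (27)-symmetry of `Δπ` and the DISPLAYED column letter `θ_E′` of the COMPOSITE `Δπ∘(HD)′(A′)` (linear in `‖A′‖`).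
[cite: Balaban1985Variational, (88) p.291, (73) p.289, (46) p.285] -/
theorem norm_W2_le_composite (RC : Regime H 0 C b 0 C₂ c₄ 0 aC εC) (Δπ : Space115 L η lev₀ lev₁ Dc →L[ℂ] NegSize L η lev₀ 3 𝔸)
    (hsym : ∀ Y₁ Y₂ : Space115 L η lev₀ lev₁ Dc,
      ∑ b' : Bond d Pd, τ (NegSup.equiv (levWeight L η lev₀ 3) 𝔸 (Δπ Y₁) b' * flat115 Y₂ b') =
        ∑ b' : Bond d Pd, τ (NegSup.equiv (levWeight L η lev₀ 3) 𝔸 (Δπ Y₂) b' * flat115 Y₁ b'))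
    {A' : Space115 L η lev₀ lev₁ Dc} (hA' : ‖A'‖ < aC) {N₁ θE' : ℝ} (hN₁0 : 0 ≤ N₁) (hθE' : 0 ≤ θE')
    (hN₁ : ∀ X : 𝒳, ‖Δπ (H X)‖ ≤ N₁ * ‖X‖)
    (hΘ' : ∀ (bb : Bond d Pd) (X : 𝔸), ∑ b' : Bond d Pd, levWeight L η lev₀ 3 bb / levWeight L η lev₀ 1 b'
      * ‖NegSup.equiv (levWeight L η lev₀ 3) 𝔸 (Δπ ((fderiv ℂ (Emap H C εC) A') (single115 bb X))) b'‖ ≤ θE' * ‖A'‖ * ‖X‖) :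
    ‖W2 ρ τ H C εC Δπ A'‖ ≤ (N₁ * C₂ * (1 / (1 - 4 * b * C₂ * (εC + aC))) ^ 2 + ‖ρ‖ * ‖τ‖ * θE') * ‖A'‖ ^ 2 := by
  rw [W2, norm_neg]
  have h1 := norm_Δπ_Emap_le RC Δπ hN₁0 hN₁ hA'
  have h2 : ‖transCur ρ τ (fderiv ℂ (Emap H C εC) A') (Δπ A')‖ ≤ ‖ρ‖ * ‖τ‖ * θE' * ‖A'‖ ^ 2 := by
    calc ‖transCur ρ τ (fderiv ℂ (Emap H C εC) A') (Δπ A')‖ ≤ ‖ρ‖ * ‖τ‖ * (θE' * ‖A'‖) * ‖A'‖ :=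
          norm_transCur_le_of_symm ρ τ _ Δπ hsym (Θ := θE' * ‖A'‖) (by positivity) hΘ' A'
      _ = ‖ρ‖ * ‖τ‖ * θE' * ‖A'‖ ^ 2 := by ring
  calc ‖Δπ (Emap H C εC A') + transCur ρ τ (fderiv ℂ (Emap H C εC) A') (Δπ A')‖
      ≤ ‖Δπ (Emap H C εC A')‖ + ‖transCur ρ τ (fderiv ℂ (Emap H C εC) A') (Δπ A')‖ := norm_add_le _ _
    _ ≤ _ := by rw [add_mul]; exact add_le_add h1 h2

/-- **(89)-form through `N₁`: `‖W₃(A′)‖₍₋₃₎ ≤ ‖ρ‖‖τ‖θ_E·N₁C₂ℓ²·R′·‖A′‖²`** on `‖A′‖ < R′ ≤ a_C` — the old transpose route `‖MᵗK‖ ≤ ‖ρ‖‖τ‖θ_E‖A′‖·‖K‖`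
with `K = Δπ HD(A′)` sized by `norm_Δπ_Emap_le` (no `‖Δπ‖`). [cite: Balaban1985Variational, (89) p.291] -/
theorem norm_W3_le_composite (RC : Regime H 0 C b 0 C₂ c₄ 0 aC εC) (Δπ : Space115 L η lev₀ lev₁ Dc →L[ℂ] NegSize L η lev₀ 3 𝔸)
    {A' : Space115 L η lev₀ lev₁ Dc} {R' : ℝ} (hA' : ‖A'‖ < R') (hR'a : R' ≤ aC) {N₁ θE : ℝ} (hN₁0 : 0 ≤ N₁) (hθE : 0 ≤ θE)
    (hN₁ : ∀ X : 𝒳, ‖Δπ (H X)‖ ≤ N₁ * ‖X‖)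
    (hΘE : ∀ bb : Bond d Pd, ∑ b' : Bond d Pd, levWeight L η lev₀ 3 bb / levWeight L η lev₀ 3 b'
      * ‖kernel (fderiv ℂ (Emap H C εC) A') b' bb‖ ≤ θE * ‖A'‖) :
    ‖W3 ρ τ H C εC Δπ A'‖ ≤ ‖ρ‖ * ‖τ‖ * θE * (N₁ * C₂ * (1 / (1 - 4 * b * C₂ * (εC + aC))) ^ 2) * R' * ‖A'‖ ^ 2 := by
  have hA'a : ‖A'‖ < aC := lt_of_lt_of_le hA' hR'a
  have hNC : 0 ≤ N₁ * C₂ * (1 / (1 - 4 * b * C₂ * (εC + aC))) ^ 2 := by have := RC.C₄_nonneg; positivity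
  rw [W3]
  calc ‖transCur ρ τ (fderiv ℂ (Emap H C εC) A') (Δπ (Emap H C εC A'))‖
      ≤ ‖ρ‖ * ‖τ‖ * (θE * ‖A'‖) * ‖Δπ (Emap H C εC A')‖ := norm_transCur_le ρ τ _ (by positivity) hΘE _
    _ ≤ ‖ρ‖ * ‖τ‖ * (θE * ‖A'‖) * (N₁ * C₂ * (1 / (1 - 4 * b * C₂ * (εC + aC))) ^ 2 * ‖A'‖ ^ 2) := by
        gcongr; exact norm_Δπ_Emap_le RC Δπ hN₁0 hN₁ hA'a
    _ = ‖ρ‖ * ‖τ‖ * θE * (N₁ * C₂ * (1 / (1 - 4 * b * C₂ * (εC + aC))) ^ 2) * ‖A'‖ * ‖A'‖ ^ 2 := by ring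
    _ ≤ ‖ρ‖ * ‖τ‖ * θE * (N₁ * C₂ * (1 / (1 - 4 * b * C₂ * (εC + aC))) ^ 2) * R' * ‖A'‖ ^ 2 := by gcongr

/-! ## §2 Proposition 4 for `W80` with the composite constant `C₄ᶜ = ‖ρ‖‖τ‖θ₃‖J‖ + (N₁C₂ℓ² + ‖ρ‖‖τ‖θ_E′) + ‖ρ‖‖τ‖θ_E·N₁C₂ℓ²·R′ + ‖ρ‖‖τ‖(1 + θ_ER′)C_Vℓ²` (written out; `B11Eq98CurrentSlot.C4W` with `‖Δπ‖b ↦ N₁`, `θ_E‖Δπ‖ ↦ θ_E′` in the transposed W₂-row) -/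

section Prop4

variable [CompleteSpace 𝔸]

/-- **PROPOSITION 4 FOR `W80` — `‖W(A′)‖₍₋₃₎ ≤ C₄ᶜ·‖A′‖²` on `‖A′‖ < R′` — WITH THE W₂/W₃ ROWS THROUGH THE COMPOSITE LETTERS** (`hsym`, `hN₁`, `hΘ′`)
and otherwise the hypotheses of `B11Eq98CurrentSlot.norm_W80_le_sq` (`θ_E`, `θ₃` column letters on the ball, the V₀-slot, the regime, the radii).
[cite: Balaban1985Variational, Prop. 4 (97)–(98) pp.292–293, (86)–(90) p.291] -/
theorem norm_W80_le_sq_composite (U₀ : Bond d Pd → 𝔸ˣ) {CV RV : ℝ} (hCV : 0 ≤ CV)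
    (hqV : ∀ Y : Space115 L η lev₀ lev₁ Dc, ‖Y‖ < RV → ‖curV0 (lev₁ := lev₁) (Dc := Dc) ρ τ U₀ Y‖ ≤ CV * ‖Y‖ ^ 2)
    (RC : Regime H 0 C b 0 C₂ c₄ 0 aC εC) (hC : Prop4Hyp C C₂ c₄) (J : NegSize L η lev₀ 3 𝔸)
    (Δπ : Space115 L η lev₀ lev₁ Dc →L[ℂ] NegSize L η lev₀ 3 𝔸)
    (hsym : ∀ Y₁ Y₂ : Space115 L η lev₀ lev₁ Dc,
      ∑ b' : Bond d Pd, τ (NegSup.equiv (levWeight L η lev₀ 3) 𝔸 (Δπ Y₁) b' * flat115 Y₂ b') =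
        ∑ b' : Bond d Pd, τ (NegSup.equiv (levWeight L η lev₀ 3) 𝔸 (Δπ Y₂) b' * flat115 Y₁ b'))
    {R' θ₃ θE θE' N₁ : ℝ} (hθ₃ : 0 ≤ θ₃) (hθE : 0 ≤ θE) (hθE' : 0 ≤ θE') (hN₁0 : 0 ≤ N₁) (hR'0 : 0 ≤ R')
    (hR'a : R' ≤ aC) (hR'V : R' ≤ (1 - 4 * b * C₂ * (εC + aC)) * RV)
    (hN₁ : ∀ X : 𝒳, ‖Δπ (H X)‖ ≤ N₁ * ‖X‖)
    (hΘE : ∀ A' : Space115 L η lev₀ lev₁ Dc, ‖A'‖ < R' → ∀ bb : Bond d Pd, ∑ b' : Bond d Pd,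
      levWeight L η lev₀ 3 bb / levWeight L η lev₀ 3 b' * ‖kernel (fderiv ℂ (Emap H C εC) A') b' bb‖ ≤ θE * ‖A'‖)
    (hΘ' : ∀ A' : Space115 L η lev₀ lev₁ Dc, ‖A'‖ < R' → ∀ (bb : Bond d Pd) (X : 𝔸), ∑ b' : Bond d Pd,
      levWeight L η lev₀ 3 bb / levWeight L η lev₀ 1 b'
        * ‖NegSup.equiv (levWeight L η lev₀ 3) 𝔸 (Δπ ((fderiv ℂ (Emap H C εC) A') (single115 bb X))) b'‖ ≤ θE' * ‖A'‖ * ‖X‖)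
    (hΘ3 : ∀ A' : Space115 L η lev₀ lev₁ Dc, ‖A'‖ < R' → ∀ bb : Bond d Pd, ∑ b' : Bond d Pd,
      levWeight L η lev₀ 3 bb / levWeight L η lev₀ 3 b' * ‖kernel (fderiv ℂ (E3 H C εC) A') b' bb‖ ≤ θ₃ * ‖A'‖ ^ 2)
    {A' : Space115 L η lev₀ lev₁ Dc} (hA' : ‖A'‖ < R') :
    ‖W80 ρ τ U₀ H C εC J Δπ A'‖
      ≤ (‖ρ‖ * ‖τ‖ * θ₃ * ‖J‖ + (N₁ * C₂ * (1 / (1 - 4 * b * C₂ * (εC + aC))) ^ 2 + ‖ρ‖ * ‖τ‖ * θE')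
            + ‖ρ‖ * ‖τ‖ * θE * (N₁ * C₂ * (1 / (1 - 4 * b * C₂ * (εC + aC))) ^ 2) * R'
            + ‖ρ‖ * ‖τ‖ * (1 + θE * R') * CV * (1 / (1 - 4 * b * C₂ * (εC + aC))) ^ 2) * ‖A'‖ ^ 2 := by
  have hA'a : ‖A'‖ < aC := lt_of_lt_of_le hA' hR'a
  -- the kernel of `(solA)′ = −(Emap)′` has the same columns as that of `(Emap)′`
  have hΘsol : ∀ A'' : Space115 L η lev₀ lev₁ Dc, ‖A''‖ < R' → ∀ bb : Bond d Pd, ∑ b' : Bond d Pd,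
      levWeight L η lev₀ 3 bb / levWeight L η lev₀ 3 b' * ‖kernel (fderiv ℂ (solA H 0 C 0 εC) A'') b' bb‖ ≤ θE * R' := by
    intro A'' hA'' bb
    have hs : solA H 0 C 0 εC = -(Emap H C εC : Space115 L η lev₀ lev₁ Dc → Space115 L η lev₀ lev₁ Dc) := by
      funext Y; rw [Pi.neg_apply, Emap, neg_neg]
    have hk : ∀ b', ‖kernel (fderiv ℂ (solA H 0 C 0 εC) A'') b' bb‖ = ‖kernel (fderiv ℂ (Emap H C εC) A'') b' bb‖ := by
      intro b'
      rw [hs, fderiv_neg]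
      have : kernel (-fderiv ℂ (Emap H C εC) A'') b' bb = -kernel (fderiv ℂ (Emap H C εC) A'') b' bb := by
        ext X; simp only [kernel_apply, neg_apply, map_neg, Pi.neg_apply]
      rw [this, norm_neg]
    simp only [hk]
    exact (hΘE A'' hA'' bb).trans (mul_le_mul_of_nonneg_left hA''.le hθE)
  have h45 : ‖curV0full ρ τ U₀ H C εC A'‖
      ≤ ‖ρ‖ * ‖τ‖ * (1 + θE * R') * CV * (1 / (1 - 4 * b * C₂ * (εC + aC))) ^ 2 * ‖A'‖ ^ 2 :=
    (prop4Hyp_curV0full ρ τ U₀ (CV := CV) (RV := RV)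
      ⟨hqV, fun P Q => by
        have hcur : Differentiable ℂ (curV0 (L := L) (η := η) (lev₀ := lev₀) (lev₁ := lev₁) (Dc := Dc) ρ τ U₀) :=
          (differentiable_curV0prime (lev₁ := lev₁) (Dc := Dc) ρ τ U₀).add (differentiable_curComm (lev₁ := lev₁) (Dc := Dc) ρ τ U₀)
        exact (hcur.comp ((differentiable_const P).add (differentiable_id.smul_const Q))).differentiableOn⟩
      hCV RC hC (by positivity) hΘsol hR'a hR'V).quad A' hA'
  have h1 := norm_W1_le ρ τ J hθ₃ (hΘ3 A' hA')
  have h2 := norm_W2_le_composite ρ τ RC Δπ hsym hA'a hN₁0 hθE' hN₁ (hΘ' A' hA')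
  have h3 := norm_W3_le_composite ρ τ RC Δπ hA' hR'a hN₁0 hθE hN₁ (hΘE A' hA')
  calc ‖W80 ρ τ U₀ H C εC J Δπ A'‖
      ≤ ‖W1 ρ τ H C εC J A'‖ + ‖W2 ρ τ H C εC Δπ A'‖ + ‖W3 ρ τ H C εC Δπ A'‖ + ‖curV0full ρ τ U₀ H C εC A'‖ := by
        unfold W80
        exact (norm_add_le _ _).trans (add_le_add ((norm_add_le _ _).trans (add_le_add (norm_add_le _ _) le_rfl)) le_rfl)
    _ ≤ _ := by
        nlinarith [h1, h2, h3, h45, sq_nonneg ‖A'‖]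

/-- **BOTH W-SLOT CLAUSES FOR `W80` WITH THE COMPOSITE CONSTANT `C₄ᶜ` (written out)**: `QuadAnalytic (W80 …) C₄ᶜ R′ ∧ AnalyticOnNhd ℂ (W80 …) {‖Y‖ < R′}`.
[cite: Balaban1985Variational, Prop. 4 (97)–(98) pp.292–293] -/
theorem quadAnalytic_W80_composite [CompleteSpace 𝒳] (U₀ : Bond d Pd → 𝔸ˣ) {CV RV : ℝ} (hCV : 0 ≤ CV)
    (hqV : ∀ Y : Space115 L η lev₀ lev₁ Dc, ‖Y‖ < RV → ‖curV0 (lev₁ := lev₁) (Dc := Dc) ρ τ U₀ Y‖ ≤ CV * ‖Y‖ ^ 2)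
    (RC : Regime H 0 C b 0 C₂ c₄ 0 aC εC) (hC : Prop4Hyp C C₂ c₄) (J : NegSize L η lev₀ 3 𝔸)
    (Δπ : Space115 L η lev₀ lev₁ Dc →L[ℂ] NegSize L η lev₀ 3 𝔸)
    (hsym : ∀ Y₁ Y₂ : Space115 L η lev₀ lev₁ Dc,
      ∑ b' : Bond d Pd, τ (NegSup.equiv (levWeight L η lev₀ 3) 𝔸 (Δπ Y₁) b' * flat115 Y₂ b') =
        ∑ b' : Bond d Pd, τ (NegSup.equiv (levWeight L η lev₀ 3) 𝔸 (Δπ Y₂) b' * flat115 Y₁ b'))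
    {R' θ₃ θE θE' N₁ : ℝ} (hθ₃ : 0 ≤ θ₃) (hθE : 0 ≤ θE) (hθE' : 0 ≤ θE') (hN₁0 : 0 ≤ N₁) (hR'0 : 0 ≤ R')
    (hR'a : R' ≤ aC) (hR'V : R' ≤ (1 - 4 * b * C₂ * (εC + aC)) * RV)
    (hN₁ : ∀ X : 𝒳, ‖Δπ (H X)‖ ≤ N₁ * ‖X‖)
    (hΘE : ∀ A' : Space115 L η lev₀ lev₁ Dc, ‖A'‖ < R' → ∀ bb : Bond d Pd, ∑ b' : Bond d Pd,
      levWeight L η lev₀ 3 bb / levWeight L η lev₀ 3 b' * ‖kernel (fderiv ℂ (Emap H C εC) A') b' bb‖ ≤ θE * ‖A'‖)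
    (hΘ' : ∀ A' : Space115 L η lev₀ lev₁ Dc, ‖A'‖ < R' → ∀ (bb : Bond d Pd) (X : 𝔸), ∑ b' : Bond d Pd,
      levWeight L η lev₀ 3 bb / levWeight L η lev₀ 1 b'
        * ‖NegSup.equiv (levWeight L η lev₀ 3) 𝔸 (Δπ ((fderiv ℂ (Emap H C εC) A') (single115 bb X))) b'‖ ≤ θE' * ‖A'‖ * ‖X‖)
    (hΘ3 : ∀ A' : Space115 L η lev₀ lev₁ Dc, ‖A'‖ < R' → ∀ bb : Bond d Pd, ∑ b' : Bond d Pd,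
      levWeight L η lev₀ 3 bb / levWeight L η lev₀ 3 b' * ‖kernel (fderiv ℂ (E3 H C εC) A') b' bb‖ ≤ θ₃ * ‖A'‖ ^ 2) :
    QuadAnalytic (W80 ρ τ U₀ H C εC J Δπ) ((‖ρ‖ * ‖τ‖ * θ₃ * ‖J‖ + (N₁ * C₂ * (1 / (1 - 4 * b * C₂ * (εC + aC))) ^ 2 + ‖ρ‖ * ‖τ‖ * θE')
            + ‖ρ‖ * ‖τ‖ * θE * (N₁ * C₂ * (1 / (1 - 4 * b * C₂ * (εC + aC))) ^ 2) * R'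
            + ‖ρ‖ * ‖τ‖ * (1 + θE * R') * CV * (1 / (1 - 4 * b * C₂ * (εC + aC))) ^ 2)) R' ∧
      AnalyticOnNhd ℂ (W80 ρ τ U₀ H C εC J Δπ) {Y : Space115 L η lev₀ lev₁ Dc | ‖Y‖ < R'} := by
  have han := analyticOnNhd_W80_lt ρ τ U₀ RC hC J Δπ hR'a
  refine ⟨⟨fun _ hY => norm_W80_le_sq_composite ρ τ U₀ hCV hqV RC hC J Δπ hsym hθ₃ hθE hθE' hN₁0 hR'0 hR'a hR'V hN₁ hΘE hΘ' hΘ3 hY,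
    fun P Q => ?_⟩, han⟩
  have hline : Differentiable ℂ (fun ζ : ℂ => P + ζ • Q) := (differentiable_const P).add (differentiable_id.smul_const Q)
  exact han.differentiableOn.comp hline.differentiableOn fun ζ hζ => hζ

/-- The same packaged as `B11Prop6Scheme.Prop4Hyp` (Fréchet form). [cite: Balaban1985Variational, Prop. 4 (98) p.293] -/
theorem prop4Hyp_W80_composite [CompleteSpace 𝒳] (U₀ : Bond d Pd → 𝔸ˣ) {CV RV : ℝ} (hCV : 0 ≤ CV)
    (hqV : ∀ Y : Space115 L η lev₀ lev₁ Dc, ‖Y‖ < RV → ‖curV0 (lev₁ := lev₁) (Dc := Dc) ρ τ U₀ Y‖ ≤ CV * ‖Y‖ ^ 2)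
    (RC : Regime H 0 C b 0 C₂ c₄ 0 aC εC) (hC : Prop4Hyp C C₂ c₄) (J : NegSize L η lev₀ 3 𝔸)
    (Δπ : Space115 L η lev₀ lev₁ Dc →L[ℂ] NegSize L η lev₀ 3 𝔸)
    (hsym : ∀ Y₁ Y₂ : Space115 L η lev₀ lev₁ Dc,
      ∑ b' : Bond d Pd, τ (NegSup.equiv (levWeight L η lev₀ 3) 𝔸 (Δπ Y₁) b' * flat115 Y₂ b') =
        ∑ b' : Bond d Pd, τ (NegSup.equiv (levWeight L η lev₀ 3) 𝔸 (Δπ Y₂) b' * flat115 Y₁ b'))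
    {R' θ₃ θE θE' N₁ : ℝ} (hθ₃ : 0 ≤ θ₃) (hθE : 0 ≤ θE) (hθE' : 0 ≤ θE') (hN₁0 : 0 ≤ N₁) (hR'0 : 0 ≤ R')
    (hR'a : R' ≤ aC) (hR'V : R' ≤ (1 - 4 * b * C₂ * (εC + aC)) * RV)
    (hN₁ : ∀ X : 𝒳, ‖Δπ (H X)‖ ≤ N₁ * ‖X‖)
    (hΘE : ∀ A' : Space115 L η lev₀ lev₁ Dc, ‖A'‖ < R' → ∀ bb : Bond d Pd, ∑ b' : Bond d Pd,
      levWeight L η lev₀ 3 bb / levWeight L η lev₀ 3 b' * ‖kernel (fderiv ℂ (Emap H C εC) A') b' bb‖ ≤ θE * ‖A'‖)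
    (hΘ' : ∀ A' : Space115 L η lev₀ lev₁ Dc, ‖A'‖ < R' → ∀ (bb : Bond d Pd) (X : 𝔸), ∑ b' : Bond d Pd,
      levWeight L η lev₀ 3 bb / levWeight L η lev₀ 1 b'
        * ‖NegSup.equiv (levWeight L η lev₀ 3) 𝔸 (Δπ ((fderiv ℂ (Emap H C εC) A') (single115 bb X))) b'‖ ≤ θE' * ‖A'‖ * ‖X‖)
    (hΘ3 : ∀ A' : Space115 L η lev₀ lev₁ Dc, ‖A'‖ < R' → ∀ bb : Bond d Pd, ∑ b' : Bond d Pd,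
      levWeight L η lev₀ 3 bb / levWeight L η lev₀ 3 b' * ‖kernel (fderiv ℂ (E3 H C εC) A') b' bb‖ ≤ θ₃ * ‖A'‖ ^ 2) :
    Prop4Hyp (W80 ρ τ U₀ H C εC J Δπ) ((‖ρ‖ * ‖τ‖ * θ₃ * ‖J‖ + (N₁ * C₂ * (1 / (1 - 4 * b * C₂ * (εC + aC))) ^ 2 + ‖ρ‖ * ‖τ‖ * θE')
            + ‖ρ‖ * ‖τ‖ * θE * (N₁ * C₂ * (1 / (1 - 4 * b * C₂ * (εC + aC))) ^ 2) * R'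
            + ‖ρ‖ * ‖τ‖ * (1 + θE * R') * CV * (1 / (1 - 4 * b * C₂ * (εC + aC))) ^ 2)) R' where
  quad _ hY := norm_W80_le_sq_composite ρ τ U₀ hCV hqV RC hC J Δπ hsym hθ₃ hθE hθE' hN₁0 hR'0 hR'a hR'V hN₁ hΘE hΘ' hΘ3 hY
  differentiableOn := (analyticOnNhd_W80_lt ρ τ U₀ RC hC J Δπ hR'a).differentiableOn

end Prop4

end Literature.MathematicalPhysics.QuantumFieldTheory.Balaban1983to89.B11Eq98W80Composite

end
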